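import Mathlib
import Summits.ValiantsHypothesis.ValiantsHypothesis.Theorems.NewtonUnitEquationsDissociatedUniformTotalsLaw
import Summits.ValiantsHypothesis.ValiantsHypothesis.Theorems.NewtonUnitEquationsDissociatedUniformTotalsLawUnimodal
import Summits.ValiantsHypothesis.ValiantsHypothesis.Theorems.NewtonUnitEquationsDissociatedUniformTotalsLawChains
import Summits.ValiantsHypothesis.ValiantsHypothesis.Theorems.NewtonUnitEquationsDissociatedUniformTotalsLawHexagon
import Summits.ValiantsHypothesis.ValiantsHypothesis.Theorems.NewtonUnitEquationsDissociatedUniformTotalsLawHexagonCount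
import Summits.ValiantsHypothesis.ValiantsHypothesis.Theorems.NewtonUnitEquationsDissociatedUniformTotalsLawHodograph
import Summits.ValiantsHypothesis.ValiantsHypothesis.Theorems.NewtonUnitEquationsDissociatedUniformTotalsLawHodographFamilies
import Summits.ValiantsHypothesis.ValiantsHypothesis.Theorems.NewtonUnitEquationsDissociatedUniformTotalsLawHodographRelabel
import HarnessLib

/-!
# Crux `NewtonUnitEquations.DissociatedUniform` (stmt-ValiantsHypothesis-5905), `n = 3` totals law of model (Q**):
# MULTIPLIER (winding) labellings — crossing number `2·min(m, q − m)` and `T ≤ 2(m_a + m_b + m_c)·q² + 6Z`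

The census families of NOTES-d1g3 §3 carry MULTIPLIERS: a smooth curve `C` read with labels `k ↦ C(u k)` for a unit `u` of `ℤ/q`
("circle(m)", parabola pairs × `c₃` with multipliers).  Such a curve is NOT hodograph-convex (its edge vectors `C(uk+u) − C(uk)` are the
`u`-step CHORD VECTORS `chordVec C u j = C(j+u) − C j` read in star order `j = uk`), but its hodograph has small affine CROSSING NUMBER:

* `CycUnimodalAt.min_le_of_between` (quasi-concavity along positions), `sum_indic_downcross_step_le` / `sum_indic_upcross_step_le`:
  a cyclically unimodal `f` has at most `m` labels `j` with `f j > t > f (j + m)` (resp. `<, <`), `m < q`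
  (the superlevel set is an interval of positions; only its last / first `m` positions can exit / enter it in one `m`-step);
* `sum_indic_cross_step_le` (`'`): hence at most `2m` (and at most `2(q − m)`) strict sign changes of `(f j − t)(f(j+m) − t)`;
* **`fewCrossings_comp_unitMul`**: if `V` is convexly ordered then `k ↦ V(u k)` has crossing number `≤ 2·min(u.val, q − u.val)`;
* `edgeVec_comp_mul`: `Δ(C ∘ (u·)) = (chordVec C u) ∘ (u·)`;
* **`totalVert_le_of_multipliers`**: if the chord curves `chordVec A u_a`, `chordVec B u_b`, `chordVec C u_c` are convexly ordered then
  `T(A∘(u_a·), B∘(u_b·), C∘(u_c·)) ≤ 2(m_a + m_b + m_c)·q² + 6Z`, `m_i = min(u_i.val, q − u_i.val)` — the law degrades LINEARLY in the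
  winding numbers and recovers `6q²` at `u = ±1`.  (For a circle, `chordVec` is again a circle; for the census parabola `(k, k²)` it is two
  monotone runs on two vertical lines — convexly ordered; neither instance is typed here.)

`TotalsLawThree C` (arbitrary labellings) remains OPEN; VP ≠ VNP is not touched.
[folklore: a cyclic interval loses at most `m` elements under a shift by `m`]
-/

set_option linter.dupNamespace false -- `ValiantsHypothesis.ValiantsHypothesis` (summit = problem) in every name

open scoped BigOperators Pointwise

namespace Summit.ValiantsHypothesis.ValiantsHypothesis.Theorems.NewtonUnitEquationsDissociatedUniform

namespace TotalsLaw

open Matrix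

section Steps

variable {q : ℕ} [NeZero q]

omit [NeZero q] in
/-- `∑ indic = card filter` (classical). [folklore] -/
theorem sum_indic_eq_card_filter {ι : Type*} [Fintype ι] (P : ι → Prop) [DecidablePred P] :
    ∑ k, indic (P k) = (Finset.univ.filter fun k => P k).card := by
  rw [Finset.card_filter]
  refine Finset.sum_congr rfl fun k _ => ?_
  unfold indic
  congr 1

omit [NeZero q] in
/-- **Quasi-concavity along positions.**  For `f` cyclically unimodal with witness `(n, d)` and positions `p₁ ≤ p₂ ≤ p₃ < q`
(counted from `n`), `min (f (n+p₁)) (f (n+p₃)) ≤ f (n+p₂)`. [folklore] -/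
theorem CycUnimodalAt.min_le_of_between {f : ZMod q → ℝ} {n : ZMod q} {d : ℕ} (h : CycUnimodalAt f n d) {p₁ p₂ p₃ : ℕ}
    (h12 : p₁ ≤ p₂) (h23 : p₂ ≤ p₃) (h3 : p₃ < q) :
    min (f (n + (p₁ : ZMod q))) (f (n + (p₃ : ZMod q))) ≤ f (n + (p₂ : ZMod q)) := by
  rcases le_total p₂ d with hle | hge
  · exact (min_le_left _ _).trans (h.asc_le h12 hle)
  · exact (min_le_right _ _).trans (h.desc_le hge h23 h3)

/-- Position bookkeeping: if the position of `j` plus `m` stays below `q`, the position of `j + m` is that sum. [folklore] -/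
theorem val_add_step (n j : ZMod q) {m : ℕ} (h : (j - n).val + m < q) : ((j + (m : ZMod q)) - n).val = (j - n).val + m := by
  have e : j + (m : ZMod q) - n = (((j - n).val + m : ℕ) : ZMod q) := by
    push_cast; rw [ZMod.natCast_zmod_val]; ring
  rw [e, ZMod.val_cast_of_lt h]

/-- Conversely, if the position of `j + m` is at least `m` (`m < q`), the position of `j` is `m` less. [folklore] -/
theorem val_sub_step (n j : ZMod q) {m : ℕ} (h : m ≤ ((j + (m : ZMod q)) - n).val) :
    (j - n).val = ((j + (m : ZMod q)) - n).val - m := by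
  set p := ((j + (m : ZMod q)) - n).val with hp
  have hpq : p < q := ZMod.val_lt _
  have e : j - n = (((p - m : ℕ)) : ZMod q) := by
    have e1 : j + (m : ZMod q) - n = (p : ZMod q) := by rw [hp, ZMod.natCast_zmod_val]
    have : j - n = (j + (m : ZMod q) - n) - (m : ZMod q) := by ring
    rw [this, e1, Nat.cast_sub h]
  have hmq' : p - m < q := by omega
  rw [e, ZMod.val_cast_of_lt hmq']

/-- **At most `m` down-crossings at step `m`**: `#{j : f j > t > f (j + m)} ≤ m` for `f` cyclically unimodal. [folklore] -/
theorem sum_indic_downcross_step_le {f : ZMod q → ℝ} (hf : CycUnimodal f) (t : ℝ) (m : ℕ) :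
    ∑ j : ZMod q, indic (t < f j ∧ f (j + (m : ZMod q)) < t) ≤ m := by
  classical
  obtain ⟨n, d, h⟩ := hf
  rw [sum_indic_eq_card_filter]
  set S := Finset.univ.filter fun j : ZMod q => t < f j ∧ f (j + (m : ZMod q)) < t with hS
  by_cases hne : S.Nonempty
  · -- `β` = the largest position of a label above `t`
    set U := Finset.univ.filter fun j : ZMod q => t < f j with hU
    have hUne : U.Nonempty := by
      obtain ⟨j, hj⟩ := hne
      rw [hS, Finset.mem_filter] at hj
      exact ⟨j, by rw [hU, Finset.mem_filter]; exact ⟨Finset.mem_univ _, hj.2.1⟩⟩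
    have hIne : (U.image fun j => (j - n).val).Nonempty := hUne.image _
    set β := (U.image fun j => (j - n).val).max' hIne with hβ
    obtain ⟨jβ, hjβU, hjβ⟩ := Finset.mem_image.1 ((U.image fun j => (j - n).val).max'_mem hIne)
    have hβq : β < q := by rw [hβ, ← hjβ]; exact ZMod.val_lt _
    have hfβ : t < f (n + (β : ZMod q)) := by
      rw [hβ, ← hjβ, ← eq_add_val n jβ]
      rw [hU, Finset.mem_filter] at hjβU
      exact hjβU.2
    have hle : ∀ j ∈ U, (j - n).val ≤ β := fun j hj =>
      Finset.le_max' (U.image fun j => (j - n).val) ((j - n).val) (Finset.mem_image.2 ⟨j, hj, rfl⟩)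
    -- every `j ∈ S` has position `p` with `β < p + m ≤ β + m`
    have key : ∀ j ∈ S, β < (j - n).val + m ∧ (j - n).val + m ≤ β + m := by
      intro j hj
      rw [hS, Finset.mem_filter] at hj
      have hjU : j ∈ U := by rw [hU, Finset.mem_filter]; exact ⟨Finset.mem_univ _, hj.2.1⟩
      refine ⟨?_, Nat.add_le_add_right (hle j hjU) m⟩
      by_contra hcon
      push Not at hcon
      have hpos : ((j + (m : ZMod q)) - n).val = (j - n).val + m := val_add_step n j (by omega)
      have hb := h.min_le_of_between (p₁ := (j - n).val) (p₂ := (j - n).val + m) (p₃ := β) (by omega) hcon hβq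
      rw [← hpos, ← eq_add_val n (j + (m : ZMod q)), ← eq_add_val n j] at hb
      have : t < min (f j) (f (n + (β : ZMod q))) := lt_min hj.2.1 hfβ
      linarith [hj.2.2]
    calc S.card ≤ (Finset.Ioc β (β + m)).card :=
          Finset.card_le_card_of_injOn (fun j => (j - n).val + m) (fun j hj => Finset.mem_Ioc.2 (key j hj))
            (fun j₁ _ j₂ _ e => by
              have e' : (j₁ - n).val = (j₂ - n).val := by simpa using e
              rw [eq_add_val n j₁, eq_add_val n j₂, e'])
      _ ≤ m := by rw [Nat.card_Ioc]; omega
  · rw [Finset.not_nonempty_iff_eq_empty.1 hne, Finset.card_empty]; exact Nat.zero_le _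

/-- **At most `m` up-crossings at step `m`**: `#{j : f j < t < f (j + m)} ≤ m`. [folklore] -/
theorem sum_indic_upcross_step_le {f : ZMod q → ℝ} (hf : CycUnimodal f) (t : ℝ) (m : ℕ) :
    ∑ j : ZMod q, indic (f j < t ∧ t < f (j + (m : ZMod q))) ≤ m := by
  classical
  obtain ⟨n, d, h⟩ := hf
  rw [sum_indic_eq_card_filter]
  set S := Finset.univ.filter fun j : ZMod q => f j < t ∧ t < f (j + (m : ZMod q)) with hS
  by_cases hne : S.Nonempty
  · set U := Finset.univ.filter fun j : ZMod q => t < f j with hU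
    have hUne : U.Nonempty := by
      obtain ⟨j, hj⟩ := hne
      rw [hS, Finset.mem_filter] at hj
      exact ⟨j + (m : ZMod q), by rw [hU, Finset.mem_filter]; exact ⟨Finset.mem_univ _, hj.2.2⟩⟩
    have hIne : (U.image fun j => (j - n).val).Nonempty := hUne.image _
    set α := (U.image fun j => (j - n).val).min' hIne with hα
    set β := (U.image fun j => (j - n).val).max' hIne with hβ
    obtain ⟨jα, hjαU, hjα⟩ := Finset.mem_image.1 ((U.image fun j => (j - n).val).min'_mem hIne)
    obtain ⟨jβ, hjβU, hjβ⟩ := Finset.mem_image.1 ((U.image fun j => (j - n).val).max'_mem hIne)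
    have hβq : β < q := by rw [hβ, ← hjβ]; exact ZMod.val_lt _
    have hfα : t < f (n + (α : ZMod q)) := by
      rw [hα, ← hjα, ← eq_add_val n jα]
      rw [hU, Finset.mem_filter] at hjαU
      exact hjαU.2
    have hfβ : t < f (n + (β : ZMod q)) := by
      rw [hβ, ← hjβ, ← eq_add_val n jβ]
      rw [hU, Finset.mem_filter] at hjβU
      exact hjβU.2
    have hge : ∀ j ∈ U, α ≤ (j - n).val := fun j hj =>
      Finset.min'_le (U.image fun j => (j - n).val) ((j - n).val) (Finset.mem_image.2 ⟨j, hj, rfl⟩)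
    have hle : ∀ j ∈ U, (j - n).val ≤ β := fun j hj =>
      Finset.le_max' (U.image fun j => (j - n).val) ((j - n).val) (Finset.mem_image.2 ⟨j, hj, rfl⟩)
    -- every `j ∈ S` has the position of `j + m` in `[α, α + m)`
    have key : ∀ j ∈ S, α ≤ ((j + (m : ZMod q)) - n).val ∧ ((j + (m : ZMod q)) - n).val < α + m := by
      intro j hj
      rw [hS, Finset.mem_filter] at hj
      have hjU : j + (m : ZMod q) ∈ U := by rw [hU, Finset.mem_filter]; exact ⟨Finset.mem_univ _, hj.2.2⟩
      refine ⟨hge _ hjU, ?_⟩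
      by_contra hcon
      push Not at hcon
      have hp : (j - n).val = ((j + (m : ZMod q)) - n).val - m := val_sub_step n j (by omega)
      have hjβ' := hle _ hjU
      have hb := h.min_le_of_between (p₁ := α) (p₂ := (j - n).val) (p₃ := β) (by omega) (by omega) hβq
      rw [← eq_add_val n j] at hb
      have : t < min (f (n + (α : ZMod q))) (f (n + (β : ZMod q))) := lt_min hfα hfβ
      linarith [hj.2.1]
    calc S.card ≤ (Finset.Ico α (α + m)).card :=
          Finset.card_le_card_of_injOn (fun j => ((j + (m : ZMod q)) - n).val) (fun j hj => Finset.mem_Ico.2 (key j hj))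
            (fun j₁ _ j₂ _ e => by
              have e' : ((j₁ + (m : ZMod q)) - n).val = ((j₂ + (m : ZMod q)) - n).val := e
              have e2 : j₁ + (m : ZMod q) = j₂ + (m : ZMod q) := by
                rw [eq_add_val n (j₁ + (m : ZMod q)), eq_add_val n (j₂ + (m : ZMod q)), e']
              exact add_right_cancel e2)
      _ ≤ m := by rw [Nat.card_Ico]; omega
  · rw [Finset.not_nonempty_iff_eq_empty.1 hne, Finset.card_empty]; exact Nat.zero_le _

/-- **Strict sign changes at step `m`**: at most `2m`. [folklore] -/
theorem sum_indic_cross_step_le {f : ZMod q → ℝ} (hf : CycUnimodal f) (t : ℝ) (m : ℕ) :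
    ∑ j : ZMod q, indic ((f j - t) * (f (j + (m : ZMod q)) - t) < 0) ≤ 2 * m := by
  have hsplit : ∀ j : ZMod q, indic ((f j - t) * (f (j + (m : ZMod q)) - t) < 0) ≤
      indic (f j < t ∧ t < f (j + (m : ZMod q))) + indic (t < f j ∧ f (j + (m : ZMod q)) < t) := by
    intro j
    by_cases hk : (f j - t) * (f (j + (m : ZMod q)) - t) < 0
    · rw [indic_of_true hk]
      rcases mul_neg_iff.1 hk with ⟨h1, h2⟩ | ⟨h1, h2⟩
      · rw [indic_of_false fun h' => by linarith [h'.1], indic_of_true ⟨by linarith, by linarith⟩]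
      · rw [indic_of_true ⟨by linarith, by linarith⟩]; omega
    · rw [indic_of_false hk]; exact Nat.zero_le _
  calc ∑ j : ZMod q, indic ((f j - t) * (f (j + (m : ZMod q)) - t) < 0)
      ≤ ∑ j : ZMod q, (indic (f j < t ∧ t < f (j + (m : ZMod q))) + indic (t < f j ∧ f (j + (m : ZMod q)) < t)) :=
        Finset.sum_le_sum fun j _ => hsplit j
    _ ≤ m + m := by
        rw [Finset.sum_add_distrib]
        exact Nat.add_le_add (sum_indic_upcross_step_le hf t m) (sum_indic_downcross_step_le hf t m)
    _ = 2 * m := by ring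

/-- The complementary step: a sign change at step `m` from `j` is a sign change at step `q − m` from `j + m`, so the count is also
`≤ 2(q − m)`. [folklore] -/
theorem sum_indic_cross_step_le' {f : ZMod q → ℝ} (hf : CycUnimodal f) (t : ℝ) {m : ℕ} (hm : m < q) :
    ∑ j : ZMod q, indic ((f j - t) * (f (j + (m : ZMod q)) - t) < 0) ≤ 2 * (q - m) := by
  have h := sum_indic_cross_step_le hf t (q - m)
  have e : ∀ j : ZMod q, j + (m : ZMod q) + ((q - m : ℕ) : ZMod q) = j := by
    intro j
    rw [Nat.cast_sub hm.le, ZMod.natCast_self]; ring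
  have hre : ∑ j : ZMod q, indic ((f j - t) * (f (j + (m : ZMod q)) - t) < 0) =
      ∑ j : ZMod q, indic ((f (j + (m : ZMod q)) - t) * (f (j + (m : ZMod q) + ((q - m : ℕ) : ZMod q)) - t) < 0) := by
    refine Finset.sum_congr rfl fun j _ => ?_
    rw [e j, mul_comm]
  rw [hre]
  calc ∑ j : ZMod q, indic ((f (j + (m : ZMod q)) - t) * (f (j + (m : ZMod q) + ((q - m : ℕ) : ZMod q)) - t) < 0)
      = ∑ j : ZMod q, indic ((f j - t) * (f (j + ((q - m : ℕ) : ZMod q)) - t) < 0) :=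
        Equiv.sum_comp (Equiv.addRight (m : ZMod q)) (fun j => indic ((f j - t) * (f (j + ((q - m : ℕ) : ZMod q)) - t) < 0))
    _ ≤ 2 * (q - m) := h

end Steps

/-! ### Multiplier labellings -/

section Multipliers

variable {q : ℕ} [NeZero q]

/-- The `u`-step CHORD VECTORS of a curve: `chordVec C u j = C (j + u) − C j` (`u = 1`: the hodograph `edgeVec`). -/
def chordVec (C : ZMod q → (Fin 2 → ℝ)) (u : ZMod q) (j : ZMod q) : Fin 2 → ℝ := C (j + u) - C j

omit [NeZero q] in
/-- The hodograph of a multiplier labelling is the chord curve read in star order: `Δ(C ∘ (u·)) k = chordVec C u (u k)`. [folklore] -/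
theorem edgeVec_comp_mul (C : ZMod q → (Fin 2 → ℝ)) (u k : ZMod q) :
    edgeVec (fun k => C (u * k)) k = chordVec C u (u * k) := by
  simp only [edgeVec, chordVec, mul_add, mul_one]

/-- **Crossing number of a star-order reading.**  If `V` is convexly ordered then `k ↦ V(u k)` (`u` a unit) changes the sign of any
affine functional strictly at most `2·min(u.val, q − u.val)` times. [folklore] -/
theorem fewCrossings_comp_unitMul {V : ZMod q → (Fin 2 → ℝ)} (hV : ConvexlyOrdered V) (u : (ZMod q)ˣ) :
    FewCrossings (fun k => V ((u : ZMod q) * k)) (2 * min (u : ZMod q).val (q - (u : ZMod q).val)) := by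
  intro w t
  set m := (u : ZMod q).val with hm
  have hmq : m < q := ZMod.val_lt _
  have hum : (u : ZMod q) = (m : ZMod q) := (ZMod.natCast_zmod_val _).symm
  -- reindex `j = u k`
  have hre : ∑ k : ZMod q, indic ((w ⬝ᵥ V ((u : ZMod q) * k) - t) * (w ⬝ᵥ V ((u : ZMod q) * (k + 1)) - t) < 0) =
      ∑ j : ZMod q, indic ((w ⬝ᵥ V j - t) * (w ⬝ᵥ V (j + (m : ZMod q)) - t) < 0) := by
    have e : ∀ k : ZMod q, (u : ZMod q) * (k + 1) = (u : ZMod q) * k + (m : ZMod q) := by intro k; rw [mul_add, mul_one, ← hum]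
    simp_rw [e]
    exact Equiv.sum_comp (unitMulAddEquiv u).toEquiv (fun j => indic ((w ⬝ᵥ V j - t) * (w ⬝ᵥ V (j + (m : ZMod q)) - t) < 0))
  rw [hre]
  rcases Nat.eq_zero_or_pos m with hm0 | hm0
  · -- `u.val = 0` (only possible for `q = 1`): the two factors coincide, no strict sign change
    have hz : ∀ j : ZMod q, indic ((w ⬝ᵥ V j - t) * (w ⬝ᵥ V (j + (m : ZMod q)) - t) < 0) = 0 := by
      intro j
      rw [hm0, Nat.cast_zero, add_zero]
      exact indic_of_false fun hlt => by nlinarith [mul_self_nonneg (w ⬝ᵥ V j - t)]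
    rw [Finset.sum_eq_zero fun j _ => hz j]
    exact Nat.zero_le _
  rcases le_total m (q - m) with hle | hge
  · rw [min_eq_left hle]; exact sum_indic_cross_step_le (hV w) t m
  · rw [min_eq_right hge]; exact sum_indic_cross_step_le' (hV w) t hmq

variable (A B C : ZMod q → (Fin 2 → ℝ))

/-- Hodograph crossing number of a multiplier labelling with convexly ordered chord curve. [folklore] -/
theorem fewCrossings_edgeVec_comp_unitMul (u : (ZMod q)ˣ) (hA : ConvexlyOrdered (chordVec A (u : ZMod q))) :
    FewCrossings (edgeVec fun k => A ((u : ZMod q) * k)) (2 * min (u : ZMod q).val (q - (u : ZMod q).val)) := by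
  have h := fewCrossings_comp_unitMul hA u
  have e : (edgeVec fun k => A ((u : ZMod q) * k)) = fun k => chordVec A (u : ZMod q) ((u : ZMod q) * k) :=
    funext fun k => edgeVec_comp_mul A (u : ZMod q) k
  rw [e]; exact h

/-- **The totals law for multiplier labellings.**  If the chord curves `chordVec A u_a`, `chordVec B u_b`, `chordVec C u_c` are convexly
ordered then `T(A∘(u_a·), B∘(u_b·), C∘(u_c·)) ≤ 2(m_a + m_b + m_c)·q² + 6Z` with `m_i = min(u_i.val, q − u_i.val)`. [folklore] -/
theorem totalVert_le_of_multipliers (ua ub uc : (ZMod q)ˣ) (hA : ConvexlyOrdered (chordVec A (ua : ZMod q)))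
    (hB : ConvexlyOrdered (chordVec B (ub : ZMod q))) (hC : ConvexlyOrdered (chordVec C (uc : ZMod q))) :
    totalVert (fun k => A ((ua : ZMod q) * k)) (fun k => B ((ub : ZMod q) * k)) (fun k => C ((uc : ZMod q) * k)) ≤
      (2 * min (ua : ZMod q).val (q - (ua : ZMod q).val) + 2 * min (ub : ZMod q).val (q - (ub : ZMod q).val) +
          2 * min (uc : ZMod q).val (q - (uc : ZMod q).val)) * q ^ 2 +
        6 * zeroCount (fun k => A ((ua : ZMod q) * k)) (fun k => B ((ub : ZMod q) * k)) (fun k => C ((uc : ZMod q) * k)) :=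
  totalVert_le_of_fewCrossings _ _ _ (fewCrossings_edgeVec_comp_unitMul A ua hA) (fewCrossings_edgeVec_comp_unitMul B ub hB)
    (fewCrossings_edgeVec_comp_unitMul C uc hC)

end Multipliers

end TotalsLaw

end Summit.ValiantsHypothesis.ValiantsHypothesis.Theorems.NewtonUnitEquationsDissociatedUniform
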